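import Literature.MathematicalPhysics.KineticTheory.HardSphereEuler
import Literature.Analysis.FluidPDE.HardSphereDynamics
import Literature.Analysis.FluidPDE.HardSphereCollisionRecord
import HarnessLib

/-!
# Phase scripts: objects of the abstract robust-tracking theorem of the line `ignition-cascade-refutation`
# (crux `InfluenceLocality`, stmt-AtomisticToContinuum-13916; lead c2)

Design-independent core of the `ignition` field of `IsIgnitionTemplate`: a hard-sphere trajectory follows a PHASE SCRIPT.
Every particle `i` has phases `0, 1, …` (time-extended phase sets `phase i k ⊆ ℝ × 𝕋³ × ℝ³`, free-flight invariant in the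
pull-back form `x − t v ∈ …`), deadlines by which it must have left each phase, and designed events: its `k`-th event is a
collision with `partner i k`, which is then in phase `pphase i k` (all events of the cascade designs are mover-hits-resting,
so one may take `pphase = 0` for the target side). Hypotheses: (sep) admissible states of non-designed pairs are never at
contact distance; (post) a designed contact from admissible pre-states, if incoming, reflects into the next phases;
(prog) admissible pre-states of a designed pair overlap (distance `< ε`) under free flight before the mover's deadline.
Conclusion: every particle is, at every time of `[0, T]`, in its current phase and before that phase's deadline; in
particular particle `i` has undergone ≥ 1 velocity jump before `deadline i 0`.
The four landed stubs (TorusIsolatedPair, ContactPerturbation, ReflectVelPerturbation, PackingOfSeparated) are what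
discharges (post)/(prog) per event type and `packing`; (sep) is the layout certificate.
-/

namespace Summit.AtomisticToContinuum.HydrodynamicLimit.Theorems.InfluenceLocality.Negative

open MeasureTheory Set
open scoped InnerProductSpace
open Literature.Analysis.FluidPDE Literature.MathematicalPhysics.KineticTheory
open Literature.Analysis.FunctionSpaces

noncomputable section

/-- Abstract phase script for `n` particles on `𝕋³` (see module docstring). -/
structure PhaseScript (n : ℕ) where
  /-- number of designed events of particle `i` (it has phases `0 … K i`) -/
  K : Fin n → ℕ
  /-- time-extended phase sets -/
  phase : Fin n → ℕ → Set (ℝ × T3 × V3)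
  /-- particle `i` must have left phase `k` strictly before `deadline i k` (for `k < K i`) -/
  deadline : Fin n → ℕ → ℝ
  /-- partner of the `k`-th designed event of `i` -/
  partner : Fin n → ℕ → Fin n
  /-- phase of that partner before the event -/
  pphase : Fin n → ℕ → ℕ

variable {n : ℕ}

/-- `(i,k)` and `(j,l)` form a designed event (in either order). -/
def PhaseScript.Designed (S : PhaseScript n) (i : Fin n) (k : ℕ) (j : Fin n) (l : ℕ) : Prop :=
  (k < S.K i ∧ S.partner i k = j ∧ S.pphase i k = l) ∨ (l < S.K j ∧ S.partner j l = i ∧ S.pphase j l = k)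

/-- Validity of a phase script for diameter `ε` and horizon `T` (hypotheses (mutual), (inv), (sep), (post), (prog)). -/
structure PhaseScript.Valid (S : PhaseScript n) (ε T : ℝ) : Prop where
  partnerMutual : ∀ i k, k < S.K i → S.partner i k ≠ i ∧ S.pphase i k < S.K (S.partner i k) + 1 ∧
    S.partner (S.partner i k) (S.pphase i k) = i ∧ S.pphase (S.partner i k) (S.pphase i k) = k ∧
    S.pphase i k < S.K (S.partner i k)
  lastDeadline : ∀ i, T < S.deadline i (S.K i)
  deadlinePos : ∀ i, 0 < S.deadline i 0
  deadlineMono : ∀ i k, S.deadline i k ≤ S.deadline i (k + 1)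
  order : ∀ i k, k < S.K i → 1 ≤ S.pphase i k →
    S.deadline (S.partner i k) (S.pphase i k - 1) ≤ S.deadline i k
  inv : ∀ i k t (x : T3) (v : V3) s, (t, x, v) ∈ S.phase i k → 0 ≤ s →
    (t + s, x + Torus.proj (s • v), v) ∈ S.phase i k
  sep : ∀ i j k l t (xi : T3) (vi : V3) (xj : T3) (vj : V3), i ≠ j → ¬ S.Designed i k j l →
    (t, xi, vi) ∈ S.phase i k → (t, xj, vj) ∈ S.phase j l → t ≤ S.deadline i k → t ≤ S.deadline j l →
    0 ≤ t → t ≤ T → ε < Torus.euclidDist xi xj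
  post : ∀ i k t (xi : T3) (vi : V3) (xj : T3) (vj : V3), k < S.K i →
    (t, xi, vi) ∈ S.phase i k → (t, xj, vj) ∈ S.phase (S.partner i k) (S.pphase i k) →
    t ≤ S.deadline i k → 0 ≤ t → t ≤ T →
    ‖(Torus.geometry (Fin 3)).sepVec xi xj‖ = ε →
    ⟪(Torus.geometry (Fin 3)).sepVec xi xj, vi - vj⟫_ℝ < 0 →
    (t, xi, (reflectVel ((Torus.geometry (Fin 3)).sepVec xi xj) (vi, vj)).1) ∈ S.phase i (k + 1) ∧
    (t, xj, (reflectVel ((Torus.geometry (Fin 3)).sepVec xi xj) (vi, vj)).2) ∈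
      S.phase (S.partner i k) (S.pphase i k + 1)
  prog : ∀ i k t (xi : T3) (vi : V3) (xj : T3) (vj : V3), k < S.K i →
    (t, xi, vi) ∈ S.phase i k → (t, xj, vj) ∈ S.phase (S.partner i k) (S.pphase i k) →
    0 ≤ t → t ≤ S.deadline i k → S.deadline i k ≤ T →
    ∃ s, 0 ≤ s ∧ t + s < S.deadline i k ∧
      Torus.euclidDist (xi + Torus.proj (s • vi)) (xj + Torus.proj (s • vj)) < ε
  chart : ∀ i k t (x : T3) (v : V3), (t, x, v) ∈ S.phase i k → 0 ≤ t → t ≤ T →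
    ‖Torus.reprSym x‖ + (T - t) * ‖v‖ < 1 / 8

/-- Read-back of the designed-event relation: it is symmetric. -/
theorem PhaseScript.designed_symm (S : PhaseScript n) {i j : Fin n} {k l : ℕ} (h : S.Designed i k j l) :
    S.Designed j l i k := by
  rcases h with h | h
  · exact Or.inr h
  · exact Or.inl h


/-! ## Corrected validity (`TrackValid`, 2026-08-17): the predicate under which the tracking theorem holds

`PhaseScript.Valid` above is kept for the record but is superseded: with its non-strict `order` the tracking
statement is false (crossed designs A0↔B1, A1↔B0 with equal deadlines), and its `sep`/`prog` are only vacuously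
satisfiable (`sep` fails at every designed collision instant for the post-event pair at distance `ε`; `prog` fails at
`t = deadline i k`). `TrackValid` makes `order` strict, restricts `sep` to schedule-consistent pairs and to INCOMING
contacts, and asks `prog` only up to the entry bound. -/



/-- Schedule consistency of the (particle, phase) pairs `(i, k)` and `(j, l)`: no future designed event of `i` with
`j` expects `j` in a phase below `l`, and symmetrically. Two particles simultaneously in phases `k`, `l` along a
tracked trajectory are always schedule consistent; `sep` is only required for such pairs. -/
def PhaseScript.Consistent (S : PhaseScript n) (i : Fin n) (k : ℕ) (j : Fin n) (l : ℕ) : Prop :=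
  (∀ m, k ≤ m → m < S.K i → S.partner i m = j → l ≤ S.pphase i m) ∧
  (∀ m, l ≤ m → m < S.K j → S.partner j m = i → k ≤ S.pphase j m)

/-- The entry bound of the designed event `(i, k)`: the later of the deadlines by which the two partners have entered
their pre-event phases (`deadline i (k-1)`, resp. `deadline (partner i k) (pphase i k - 1)`; `0` for a phase `0`).
`prog` is only required from states at times up to this bound. -/
def PhaseScript.entryBound (S : PhaseScript n) (i : Fin n) (k : ℕ) : ℝ :=
  max (if k = 0 then 0 else S.deadline i (k - 1))
    (if S.pphase i k = 0 then 0 else S.deadline (S.partner i k) (S.pphase i k - 1))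

/-- Corrected validity of a phase script for diameter `ε` and horizon `T` (proposal). Compared with
`PhaseScript.Valid`: `order` is STRICT; `sep` is only required for schedule-consistent pairs and only excludes
INCOMING CONTACTS (an outgoing contact of the post-event states at the collision instant is unavoidable); `prog` is
only required from states at times up to the entry bound (at `t = deadline i k` it is unsatisfiable); `chart` is
dropped (unused). -/
structure PhaseScript.TrackValid (S : PhaseScript n) (ε T : ℝ) : Prop where
  /-- designed events are mutual and the partner is another particle in a pre-final phase -/
  partnerMutual : ∀ i k, k < S.K i → S.partner i k ≠ i ∧ S.pphase i k < S.K (S.partner i k) + 1 ∧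
    S.partner (S.partner i k) (S.pphase i k) = i ∧ S.pphase (S.partner i k) (S.pphase i k) = k ∧
    S.pphase i k < S.K (S.partner i k)
  /-- the final phase has no deadline within the horizon -/
  lastDeadline : ∀ i, T < S.deadline i (S.K i)
  /-- deadlines are positive -/
  deadlinePos : ∀ i, 0 < S.deadline i 0
  /-- deadlines increase -/
  deadlineMono : ∀ i k, S.deadline i k ≤ S.deadline i (k + 1)
  /-- STRICT order: the partner must have entered its pre-event phase strictly before the event's deadline -/
  order : ∀ i k, k < S.K i → 1 ≤ S.pphase i k →
    S.deadline (S.partner i k) (S.pphase i k - 1) < S.deadline i k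
  /-- phases are invariant under forward free flight -/
  inv : ∀ i k t (x : T3) (v : V3) s, (t, x, v) ∈ S.phase i k → 0 ≤ s →
    (t + s, x + Torus.proj (s • v), v) ∈ S.phase i k
  /-- no incoming contact of admissible states of a schedule-consistent, non-designed pair -/
  sep : ∀ i j k l t (xi : T3) (vi : V3) (xj : T3) (vj : V3), i ≠ j → ¬ S.Designed i k j l →
    S.Consistent i k j l → (t, xi, vi) ∈ S.phase i k → (t, xj, vj) ∈ S.phase j l →
    t ≤ S.deadline i k → t ≤ S.deadline j l → 0 ≤ t → t ≤ T →
    ‖(Torus.geometry (Fin 3)).sepVec xi xj‖ = ε →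
    0 ≤ ⟪(Torus.geometry (Fin 3)).sepVec xi xj, vi - vj⟫_ℝ
  /-- an incoming designed contact of admissible pre-event states reflects into the next phases -/
  post : ∀ i k t (xi : T3) (vi : V3) (xj : T3) (vj : V3), k < S.K i →
    (t, xi, vi) ∈ S.phase i k → (t, xj, vj) ∈ S.phase (S.partner i k) (S.pphase i k) →
    t ≤ S.deadline i k → 0 ≤ t → t ≤ T →
    ‖(Torus.geometry (Fin 3)).sepVec xi xj‖ = ε →
    ⟪(Torus.geometry (Fin 3)).sepVec xi xj, vi - vj⟫_ℝ < 0 →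
    (t, xi, (reflectVel ((Torus.geometry (Fin 3)).sepVec xi xj) (vi, vj)).1) ∈ S.phase i (k + 1) ∧
    (t, xj, (reflectVel ((Torus.geometry (Fin 3)).sepVec xi xj) (vi, vj)).2) ∈
      S.phase (S.partner i k) (S.pphase i k + 1)
  /-- progress: pre-event states of a designed pair at a time up to the entry bound overlap under free flight
  strictly before the event's deadline (so an event with inhabited pre-event phases needs
  `entryBound i k < deadline i k`, i.e. `deadline i (k - 1) < deadline i k` on the side of `i`; the partner's side
  is `order`) -/
  prog : ∀ i k t (xi : T3) (vi : V3) (xj : T3) (vj : V3), k < S.K i →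
    (t, xi, vi) ∈ S.phase i k → (t, xj, vj) ∈ S.phase (S.partner i k) (S.pphase i k) →
    0 ≤ t → t ≤ S.entryBound i k → S.deadline i k ≤ T →
    ∃ s, 0 ≤ s ∧ t + s < S.deadline i k ∧
      Torus.euclidDist (xi + Torus.proj (s • vi)) (xj + Torus.proj (s • vj)) < ε

variable {S : PhaseScript n} {ε T : ℝ}

/-- Iterated monotonicity of the deadlines. -/
theorem PhaseScript.TrackValid.deadline_mono (hS : S.TrackValid ε T) (i : Fin n) {a b : ℕ} (hab : a ≤ b) :
    S.deadline i a ≤ S.deadline i b :=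
  (monotone_nat_of_le_succ fun k => hS.deadlineMono i k) hab

/-- Deadlines are nonnegative. -/
theorem PhaseScript.TrackValid.deadline_nonneg (hS : S.TrackValid ε T) (i : Fin n) (k : ℕ) :
    0 ≤ S.deadline i k :=
  (hS.deadlinePos i).le.trans (hS.deadline_mono i (Nat.zero_le k))

/-- The entry bound is nonnegative. -/
theorem PhaseScript.TrackValid.entryBound_nonneg (hS : S.TrackValid ε T) (i : Fin n) (k : ℕ) :
    0 ≤ S.entryBound i k := by
  refine le_max_of_le_left ?_
  split_ifs
  · exact le_rfl
  · exact hS.deadline_nonneg i _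

/-- A time at most `deadline i (k - 1)` (`1 ≤ k`) is at most the entry bound of `(i, k)`. -/
theorem PhaseScript.TrackValid.le_entryBound_left {i : Fin n} {k : ℕ} {u : ℝ} (hk : 1 ≤ k)
    (hu : u ≤ S.deadline i (k - 1)) : u ≤ S.entryBound i k := by
  refine le_trans ?_ (le_max_left _ _)
  rw [if_neg (by omega)]
  exact hu

/-- A time at most `deadline (partner i k) (pphase i k - 1)` (`1 ≤ pphase i k`) is at most the entry bound. -/
theorem PhaseScript.TrackValid.le_entryBound_right {i : Fin n} {k : ℕ} {u : ℝ} (hl : 1 ≤ S.pphase i k)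
    (hu : u ≤ S.deadline (S.partner i k) (S.pphase i k - 1)) : u ≤ S.entryBound i k := by
  refine le_trans ?_ (le_max_right _ _)
  rw [if_neg (by omega)]
  exact hu


end

end Summit.AtomisticToContinuum.HydrodynamicLimit.Theorems.InfluenceLocality.Negative
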